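import Literature.Dynamics.Ergodic.ToralEndomorphismsExact
import Literature.Dynamics.Ergodic.ToralEndomorphismPeriodicPoints
import Literature.NumberTheory.DiophantineApproximation.KroneckerWeyl
import HarnessLib

/-!
# Exactness of a toral endomorphism ⟺ the kernels `ker T_Aⁿ` are dense (Rohlin, Cuntz–Vershik);
# the kernels and fibres of `T_Aⁿ` equidistribute toward the Haar measure

Layer `Literature/Dynamics/Ergodic`, namespace `Literature.Dynamics.Ergodic` (sub-namespace `ToralEndomorphism`).
General dynamics file written for lane `lit-hodgefound` (prover seat `lit-hodgefound-p31`, row g22-#1), sequel of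
`ToralEndomorphismsExact.lean` (Rohlin's criterion `⋂ₙ ℤ^d Aⁿ = 0`, Krzyżewski's theorem); its lane file
`Literature/AlgebraicGeometry/HodgeTheory/AbelianVarietyIsogenyKernelsDense.lean` reads it on complex tori and on
the complex points of abelian varieties (kernels of the iterates of an isogeny = packets of torsion points).

## The printed statement

J. Cuntz, A. Vershik, *C\*-algebras associated with endomorphisms and polymorphisms of compact abelian groups*,
Comm. Math. Phys. 321 (2013) 157–179, §2 (held text arXiv:1202.5960, chunk p0005 L15–L31), for a surjective
endomorphism `α` with finite kernel of a compact abelian group `H` with dual `G = Ĥ` and dual endomorphism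
`φ = α̂`: «We will also assume that `⋂_{n∈ℕ} φⁿG = {0}` which, by duality, means that `⋃_{n∈ℕ} Ker αⁿ` is dense
in `H` […] In ergodic theory a measure preserving endomorphism `T : X → X` is called exact if it has the property
that `⋂_{n∈ℕ} T⁻ⁿ(𝔐) = 𝔑` […] For an algebraic endomorphism of the compact group `H` this condition means
exactly that the subgroup `⋃_{n∈ℕ} Ker αⁿ` is dense in `H`.» (after V. A. Rohlin, *Exact endomorphisms of a
Lebesgue space*, AMS Transl. (2) 39 (1964) 1–36).  Here `H = 𝕋^d = (ℝ/ℤ)^d` (Mathlib's `UnitAddTorus d` with its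
Haar probability measure `volume`), `α = T_A`, `T_A x = (Σ_j A_{ij} x_j)_i` for a non-singular `A ∈ M_d(ℤ)`
(hypothesis `hT`, as in `ToralEndomorphisms.lean`), `G = ℤ^d` with `φ(k) = k A` (row vectors), so that
`⋂ₙ φⁿ G = ⋂ₙ ℤ^d Aⁿ` and `Ker αⁿ = T_A⁻ⁿ{0}`.

«By duality» is NOT run through Pontryagin duality for closed subgroups (absent from the tree); instead the file
proves the sharper, quantitative statement by Fourier analysis on `𝕋^d` and deduces the printed one:

* §0 **Weyl's criterion for finite subsets of `𝕋^d`** (`tendsto_finsetAvg_of_forall_mFourier`): if the averages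
  of every non-trivial character `χ_m` over finite sets `Sₙ ⊂ 𝕋^d` tend to `0`, the averages of every continuous
  `g` tend to `∫ g` (density of trigonometric polynomials, Mathlib's `UnitAddTorus.span_mFourier_closure_eq_top`;
  the pattern of the tree's `tendsto_avg_continuousMap_of_weyl`, Kuipers–Niederreiter Ch. 1 Thm. 6.2).
* §1 **character sums over the fibres `T_A⁻¹{x}`** (`|det A|` points each, `natCard_preimage_singleton`):
  `Σ_{T_A y = x} χ_m(y) = 0` when `m ∉ ℤ^d A` (translate the fibre by a point `y₀ ∈ ker T_A` with `χ_m(y₀) ≠ 1`,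
  the tree's `exists_apply_eq_zero_and_mFourier_ne_one`), and `= |det A| χ_k(x)` when `m = kA`.
* §2 **equidistribution** (`tendsto_finsetAvg_preimage_iterate`): under Rohlin's condition `⋂ₙ ℤ^d Aⁿ = 0`,
  `|det A|⁻ⁿ Σ_{T_Aⁿ y = xₙ} g(y) → ∫ g` for every continuous `g` and EVERY sequence of base points `xₙ` (kernels:
  `xₙ = 0`; preimages of a point: `xₙ = x`); real-valued form.
* §3 **density** (`dense_iUnion_ker_iterate_of_forall_exists`): hence `⋃ₙ ker T_Aⁿ` is dense (a Urysohn function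
  vanishing on the closure has kernel averages `0` but positive Haar integral).
* §4 **the converse** (`forall_exists_of_dense_iUnion_ker_iterate`): if `⋃ₙ ker T_Aⁿ` is dense then
  `⋂ₙ ℤ^d Aⁿ = 0` — a character `χ_m` with `m = k_n Aⁿ` for all `n` is `≡ 1` on every kernel, hence everywhere.
* §5 **the printed theorem and its companions** for `det A ≠ 0`:
  **`isExactEndomorphism_iff_dense_iUnion_ker_iterate`** (`T_A` exact ⟺ `⋃ₙ ker T_Aⁿ` dense),
  `dense_iUnion_ker_iterate_iff_forall_exists` (⟺ Rohlin's condition),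
  `dense_iUnion_ker_iterate_iff_forall_not_dvd_charpoly` (⟺ Krzyżewski: no unimodular factor of `χ_A`),
  `isExactEndomorphism_iff_tendsto_finsetAvg_ker_iterate` (⟺ the kernels equidistribute), the expanding case and
  the automorphism case.
* §6 **the full torsion levels** `𝕋^d[m] = ker (m·)` and the `m`-division points of any `xₘ` equidistribute as
  `m → ∞` (`tendsto_finsetAvg_nsmul`; the matrix `m·1`, for which `k ∈ ℤ^d (m·1)` iff `m ∣ k`).

Theorems only: no definition, no named fact (net debt 0).

## References

* [CuntzVershik2012] J. Cuntz, A. Vershik, Comm. Math. Phys. 321 (2013) 157–179, §2 (held text arXiv:1202.5960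
  chunk p0005 L15–L31).
* [Rohlin1964] V. A. Rohlin, *Exact endomorphisms of a Lebesgue space*, Izv. Akad. Nauk SSSR 25 (1961) 499–530; AMS
  Transl. (2) 39 (1964) 1–36 (cite-only), §3 (group endomorphisms).
* [KuipersNiederreiter1974] L. Kuipers, H. Niederreiter, *Uniform Distribution of Sequences* (1974), Ch. 1 §6
  Theorems 6.2–6.3 (Weyl's criterion on `𝕋^d`).
* [Walters1982] P. Walters, *An Introduction to Ergodic Theory*, GTM 79 (1982), §0.8 (characters of `Kⁿ`, the dual
  action `[A]_t`; held text chunk p0043), §4.9 Definition 4.14 (held text chunk p0126).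
* [AndersenThomsen2012] K. K. S. Andersen, K. Thomsen, Doc. Math. 17 (2012) 545–572, §4 Theorem 4.1 (held text
  arXiv:1204.0224 chunk p0010).
* [Krzyzewski1993] K. Krzyżewski, *On exact toral endomorphisms*, Monatsh. Math. 116 (1993) 39–47 (cite-only).
-/

noncomputable section

open MeasureTheory MeasureTheory.Measure Set Filter Function Finset Matrix Topology
open Literature.NumberTheory.DiophantineApproximation

namespace Literature.Dynamics.Ergodic

/-! ### §0 Weyl's criterion for finite subsets of `𝕋^d` -/

section Weyl

variable {d : Type*} [Fintype d]

omit [Fintype d] in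
/-- Averaging over a finite subset of the torus is a `1`-Lipschitz functional on `C(𝕋^d, ℂ)`.
[cite: KuipersNiederreiter1974, Ch. 1 §6 proof of Theorem 6.2] -/
theorem lipschitzWith_finsetAvg (s : Finset (UnitAddTorus d)) :
    LipschitzWith 1 (fun F : C(UnitAddTorus d, ℂ) ↦ (∑ y ∈ s, F y) / (s.card : ℂ)) := by
  refine LipschitzWith.of_dist_le_mul fun F G ↦ ?_
  rw [NNReal.coe_one, one_mul, dist_eq_norm, dist_eq_norm, ← sub_div, ← Finset.sum_sub_distrib, norm_div,
    Complex.norm_natCast]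
  rcases s.eq_empty_or_nonempty with rfl | hs
  · simp
  · rw [div_le_iff₀ (by exact_mod_cast hs.card_pos)]
    calc ‖∑ y ∈ s, (F y - G y)‖
        ≤ ∑ y ∈ s, ‖F y - G y‖ := norm_sum_le _ _
      _ ≤ ∑ _y ∈ s, ‖F - G‖ := Finset.sum_le_sum fun y _ ↦ (F - G).norm_coe_le_norm y
      _ = ‖F - G‖ * s.card := by rw [Finset.sum_const, nsmul_eq_mul, mul_comm]

/-- **Weyl's criterion for a sequence of finite subsets `Sₙ` of the torus `(ℝ/ℤ)^d`.** If for every lattice point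
`m ≠ 0` the character averages `|Sₙ|⁻¹ Σ_{y ∈ Sₙ} χ_m(y)` tend to `0` (and the `Sₙ` are eventually non-empty), then
`|Sₙ|⁻¹ Σ_{y ∈ Sₙ} g(y) → ∫ g dθ` for every continuous `g : (ℝ/ℤ)^d → ℂ` (`dθ` = Haar probability): the set of such
`g` is closed (the averaging functionals are `1`-Lipschitz), contains the characters and their span, which is dense.
[cite: KuipersNiederreiter1974, Ch. 1 §6 Theorems 6.2–6.3 and their proof] -/
theorem tendsto_finsetAvg_of_forall_mFourier {S : ℕ → Finset (UnitAddTorus d)}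
    (hS : ∀ᶠ n in atTop, (S n).Nonempty)
    (h : ∀ m : d → ℤ, m ≠ 0 →
      Tendsto (fun n ↦ (∑ y ∈ S n, UnitAddTorus.mFourier m y) / ((S n).card : ℂ)) atTop (𝓝 0))
    (g : C(UnitAddTorus d, ℂ)) :
    Tendsto (fun n ↦ (∑ y ∈ S n, g y) / ((S n).card : ℂ)) atTop (𝓝 (∫ z : UnitAddTorus d, g z)) := by
  set P : Set C(UnitAddTorus d, ℂ) := {F | Tendsto (fun n ↦ (∑ y ∈ S n, F y) / ((S n).card : ℂ)) atTop
      (𝓝 (∫ z : UnitAddTorus d, F z))} with hP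
  -- the set of good test functions is closed …
  have hclosed : IsClosed P := by
    have heq : Equicontinuous (fun (n : ℕ) (F : C(UnitAddTorus d, ℂ)) ↦ (∑ y ∈ S n, F y) / ((S n).card : ℂ)) :=
      (LipschitzWith.uniformEquicontinuous _ 1 fun n ↦ lipschitzWith_finsetAvg (S n)).equicontinuous
    exact heq.isClosed_setOf_tendsto KroneckerWeyl.lipschitzWith_integral.continuous
  -- … contains the characters …
  have hchar : ∀ m : d → ℤ, UnitAddTorus.mFourier m ∈ P := by
    intro m
    simp only [hP, Set.mem_setOf_eq, KroneckerWeyl.integral_mFourier]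
    by_cases hm : m = 0
    · subst hm
      simp only [UnitAddTorus.mFourier_zero, ContinuousMap.one_apply, Finset.sum_const, nsmul_eq_mul, mul_one,
        if_true]
      refine tendsto_const_nhds.congr' ?_
      filter_upwards [hS] with n hn
      rw [div_self (Nat.cast_ne_zero.2 hn.card_pos.ne')]
    · rw [if_neg hm]
      exact h m hm
  -- … and their span …
  have hspan : (Submodule.span ℂ (Set.range (UnitAddTorus.mFourier (d := d))) :
      Set C(UnitAddTorus d, ℂ)) ⊆ P := by
    intro G hG
    induction hG using Submodule.span_induction with
    | mem G hG =>
      obtain ⟨m, rfl⟩ := hG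
      exact hchar m
    | zero =>
      simp only [hP, Set.mem_setOf_eq, ContinuousMap.zero_apply, Finset.sum_const_zero, zero_div, integral_zero]
      exact tendsto_const_nhds
    | add G₁ G₂ _ _ h₁ h₂ =>
      simp only [hP, Set.mem_setOf_eq, ContinuousMap.add_apply] at h₁ h₂ ⊢
      rw [integral_add (KroneckerWeyl.integrable_continuousMap G₁) (KroneckerWeyl.integrable_continuousMap G₂)]
      simpa only [Finset.sum_add_distrib, add_div] using h₁.add h₂
    | smul c G _ h =>
      simp only [hP, Set.mem_setOf_eq, ContinuousMap.smul_apply, smul_eq_mul] at h ⊢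
      rw [integral_const_mul]
      simpa only [← Finset.mul_sum, mul_div_assoc] using h.const_mul c
  -- … which is dense.
  have htop : g ∈ ((Submodule.span ℂ (Set.range (UnitAddTorus.mFourier (d := d)))).topologicalClosure :
      Set C(UnitAddTorus d, ℂ)) := by
    rw [UnitAddTorus.span_mFourier_closure_eq_top]; trivial
  rw [Submodule.topologicalClosure_coe] at htop
  exact hclosed.closure_subset_iff.2 hspan htop

/-- **Weyl's criterion for finite subsets, real-valued test functions**: under the hypothesis of
`tendsto_finsetAvg_of_forall_mFourier`, `|Sₙ|⁻¹ Σ_{y ∈ Sₙ} g(y) → ∫ g dθ` for every continuous `g : (ℝ/ℤ)^d → ℝ`.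
[cite: KuipersNiederreiter1974, Ch. 1 §6 Theorems 6.2–6.3] -/
theorem tendsto_finsetAvg_real_of_forall_mFourier {S : ℕ → Finset (UnitAddTorus d)}
    (hS : ∀ᶠ n in atTop, (S n).Nonempty)
    (h : ∀ m : d → ℤ, m ≠ 0 →
      Tendsto (fun n ↦ (∑ y ∈ S n, UnitAddTorus.mFourier m y) / ((S n).card : ℂ)) atTop (𝓝 0))
    (g : C(UnitAddTorus d, ℝ)) :
    Tendsto (fun n ↦ (∑ y ∈ S n, g y) / ((S n).card : ℝ)) atTop (𝓝 (∫ z : UnitAddTorus d, g z)) := by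
  set gc : C(UnitAddTorus d, ℂ) := (⟨Complex.ofReal, Complex.continuous_ofReal⟩ : C(ℝ, ℂ)).comp g with hgc
  have h1 := tendsto_finsetAvg_of_forall_mFourier hS h gc
  have h2 := (Complex.continuous_re.tendsto _).comp h1
  simp only [hgc, ContinuousMap.comp_apply, ContinuousMap.coe_mk, Function.comp_def] at h2
  convert h2 using 2 with n
  · rw [← Complex.ofReal_sum, ← Complex.ofReal_natCast, ← Complex.ofReal_div, Complex.ofReal_re]
  · rw [integral_complex_ofReal, Complex.ofReal_re]

/-- A character which is identically `1` on the torus is the trivial character (`∫ χ_m dθ = 0` for `m ≠ 0`).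
[folklore] -/
private theorem eq_zero_of_forall_mFourier_eq_one {m : d → ℤ} (h : ∀ y : UnitAddTorus d, UnitAddTorus.mFourier m y = 1) :
    m = 0 := by
  by_contra hm
  have h1 := KroneckerWeyl.integral_mFourier (ι := d) m
  haveI := KroneckerWeyl.isProbabilityMeasure_volume_unitAddTorus (ι := d)
  rw [if_neg hm] at h1
  simp_rw [h] at h1
  simp at h1

/-- `χ_k(0) = 1`. [folklore] -/
private theorem mFourier_apply_zero (k : d → ℤ) : UnitAddTorus.mFourier k (0 : UnitAddTorus d) = 1 := by
  simp [UnitAddTorus.mFourier]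

end Weyl

namespace ToralEndomorphism

variable {d : Type*} [Fintype d] [DecidableEq d] (A : Matrix d d ℤ)
  {T : UnitAddTorus d → UnitAddTorus d} (hT : ∀ x i, T x i = ∑ j, A i j • x j)

/-! ### §1 Character sums over the fibres `T_A⁻¹{x}` -/

omit [DecidableEq d] in
include hT in
/-- `T_A` is additive. [cite: Walters1982, §0.8 (held text chunk p0043)] -/
private theorem map_add_eq'' (x y : UnitAddTorus d) : T (x + y) = T x + T y := by
  funext i
  rw [Pi.add_apply, hT, hT, hT, ← sum_add_distrib]
  exact sum_congr rfl fun j _ ↦ by rw [Pi.add_apply, smul_add]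

include hT in
/-- **The fibres `T_A⁻¹{x}` are finite** for `det A ≠ 0` (`|det A|` points each, `natCard_preimage_singleton`).
[cite: Walters1982, §8.5 proof of Theorem 8.18 (held text chunk p0214)] -/
theorem finite_preimage_singleton (hA : A.det ≠ 0) (x : UnitAddTorus d) : (T ⁻¹' {x}).Finite := by
  have h : Nat.card (T ⁻¹' {x}) ≠ 0 := by
    rw [natCard_preimage_singleton A hT hA x]
    exact Int.natAbs_ne_zero.2 hA
  exact Set.finite_coe_iff.mp (Nat.finite_of_card_ne_zero h)

include hT in
/-- `Nat.card (T_A⁻ⁿ{x}) = |det A|ⁿ` for `det A ≠ 0`. [cite: Walters1982, §8.5 proof of Theorem 8.18 (held text chunk p0214)] -/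
theorem natCard_preimage_iterate_singleton (hA : A.det ≠ 0) (n : ℕ) (x : UnitAddTorus d) :
    Nat.card ((T^[n]) ⁻¹' {x}) = A.det.natAbs ^ n := by
  rw [natCard_preimage_singleton (A ^ n) (T := T^[n]) (iterate_apply A hT n)
    (by rw [det_pow]; exact pow_ne_zero _ hA) x, det_pow, Int.natAbs_pow]

include hT in
/-- The fibres `T_A⁻ⁿ{x}` are finite for `det A ≠ 0`. [cite: Walters1982, §8.5 proof of Theorem 8.18 (held text chunk p0214)] -/
theorem finite_preimage_iterate_singleton (hA : A.det ≠ 0) (n : ℕ) (x : UnitAddTorus d) :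
    ((T^[n]) ⁻¹' {x}).Finite :=
  finite_preimage_singleton (A ^ n) (T := T^[n]) (iterate_apply A hT n) (by rw [det_pow]; exact pow_ne_zero _ hA) x

include hT in
/-- The finite set of points of `T_A⁻ⁿ{x}` has `|det A|ⁿ` elements (`det A ≠ 0`).
[cite: Walters1982, §8.5 proof of Theorem 8.18 (held text chunk p0214)] -/
theorem card_toFinset_preimage_iterate_singleton (hA : A.det ≠ 0) (n : ℕ) (x : UnitAddTorus d) :
    (finite_preimage_iterate_singleton A hT hA n x).toFinset.card = A.det.natAbs ^ n := by
  rw [← Set.ncard_eq_toFinset_card _ (finite_preimage_iterate_singleton A hT hA n x), ← Nat.card_coe_set_eq,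
    natCard_preimage_iterate_singleton A hT hA n x]

include hT in
/-- **A non-trivial character sums to zero over every fibre of `T_A`.** For `det A ≠ 0` and `m ∉ ℤ^d A`
(`χ_m` is then non-trivial on `ker T_A`, the tree's `exists_apply_eq_zero_and_mFourier_ne_one` — «by duality»):
`Σ_{T_A y = x} χ_m(y) = 0` for every `x ∈ 𝕋^d` — translating the fibre by `y₀ ∈ ker T_A` with `χ_m(y₀) ≠ 1`
permutes it and multiplies the sum by `χ_m(y₀)`. [cite: CuntzVershik2012, §2 (held text arXiv:1202.5960 chunk p0005)]
[cite: Walters1982, §0.8 (held text chunk p0043)] -/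
theorem finsum_mFourier_preimage_singleton_eq_zero (hA : A.det ≠ 0) {m : d → ℤ} (hm : ∀ k : d → ℤ, k ᵥ* A ≠ m)
    (x : UnitAddTorus d) : ∑ᶠ y ∈ T ⁻¹' {x}, UnitAddTorus.mFourier m y = 0 := by
  have hfin := finite_preimage_singleton A hT hA x
  rw [finsum_mem_eq_finite_toFinset_sum _ hfin]
  obtain ⟨y₀, hy₀, hχ⟩ := exists_apply_eq_zero_and_mFourier_ne_one A hT hA hm
  have hmem : ∀ y, y ∈ hfin.toFinset ↔ T y = x := fun y ↦ by
    rw [Set.Finite.mem_toFinset, Set.mem_preimage, Set.mem_singleton_iff]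
  have hperm : ∑ y ∈ hfin.toFinset, UnitAddTorus.mFourier m (y + y₀) =
      ∑ y ∈ hfin.toFinset, UnitAddTorus.mFourier m y :=
    Finset.sum_equiv (Equiv.addRight y₀) (fun y ↦ by
      rw [hmem, hmem, Equiv.coe_addRight, map_add_eq'' A hT, hy₀, add_zero]) (fun _ _ ↦ rfl)
  have hmul : ∑ y ∈ hfin.toFinset, UnitAddTorus.mFourier m (y + y₀) =
      UnitAddTorus.mFourier m y₀ * ∑ y ∈ hfin.toFinset, UnitAddTorus.mFourier m y := by
    rw [Finset.mul_sum]
    exact Finset.sum_congr rfl fun y _ ↦ by rw [ToralTranslation.mFourier_apply_add, mul_comm]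
  have h3 : (1 - UnitAddTorus.mFourier m y₀) * ∑ y ∈ hfin.toFinset, UnitAddTorus.mFourier m y = 0 := by
    rw [sub_mul, one_mul, ← hmul, hperm, sub_self]
  exact (mul_eq_zero.1 h3).resolve_left (sub_ne_zero.2 hχ.symm)

include hT in
/-- **A character from `ℤ^d A` is constant on the fibres of `T_A`**: `Σ_{T_A y = x} χ_{kA}(y) = |det A| · χ_k(x)`
(`χ_{kA} = χ_k ∘ T_A`, Everest–Ward (2.1); the fibre has `|det A|` points).
[cite: CuntzVershik2012, §2 (held text arXiv:1202.5960 chunk p0005)] [cite: Walters1982, §0.8 and §8.5 proof of Theorem 8.18 (held text chunks p0043, p0214)] -/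
theorem finsum_mFourier_vecMul_preimage_singleton (hA : A.det ≠ 0) (k : d → ℤ) (x : UnitAddTorus d) :
    ∑ᶠ y ∈ T ⁻¹' {x}, UnitAddTorus.mFourier (k ᵥ* A) y = A.det.natAbs * UnitAddTorus.mFourier k x := by
  have hfin := finite_preimage_singleton A hT hA x
  rw [finsum_mem_eq_finite_toFinset_sum _ hfin]
  have hmem : ∀ y, y ∈ hfin.toFinset ↔ T y = x := fun y ↦ by
    rw [Set.Finite.mem_toFinset, Set.mem_preimage, Set.mem_singleton_iff]
  have hcard : hfin.toFinset.card = A.det.natAbs := by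
    rw [← Set.ncard_eq_toFinset_card _ hfin, ← Nat.card_coe_set_eq, natCard_preimage_singleton A hT hA x]
  rw [Finset.sum_congr rfl fun y hy ↦ (by rw [← mFourier_apply A hT k y, (hmem y).1 hy] :
      UnitAddTorus.mFourier (k ᵥ* A) y = UnitAddTorus.mFourier k x), Finset.sum_const, nsmul_eq_mul, hcard]

/-- `ℤ^d Aⁿ ⊆ ℤ^d A^N` for `N ≤ n`: if `m ∉ ℤ^d A^N` then `m ∉ ℤ^d Aⁿ`. [cite: CuntzVershik2012, §2 (held text arXiv:1202.5960 chunk p0005)] -/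
theorem forall_vecMul_pow_ne_of_le {m : d → ℤ} {N n : ℕ} (hN : ∀ k : d → ℤ, k ᵥ* A ^ N ≠ m) (hn : N ≤ n) :
    ∀ k : d → ℤ, k ᵥ* A ^ n ≠ m := by
  intro k hk
  refine hN (k ᵥ* A ^ (n - N)) ?_
  rw [vecMul_vecMul, ← pow_add, Nat.sub_add_cancel hn, hk]

include hT in
/-- **Character sums over the fibres of the iterates vanish eventually**: if `m ∉ ℤ^d A^N` then
`Σ_{T_Aⁿ y = x} χ_m(y) = 0` for all `n ≥ N` and all `x`. [cite: CuntzVershik2012, §2 (held text arXiv:1202.5960 chunk p0005)] -/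
theorem finsum_mFourier_preimage_iterate_eq_zero (hA : A.det ≠ 0) {m : d → ℤ} {N : ℕ}
    (hN : ∀ k : d → ℤ, k ᵥ* A ^ N ≠ m) {n : ℕ} (hn : N ≤ n) (x : UnitAddTorus d) :
    ∑ᶠ y ∈ (T^[n]) ⁻¹' {x}, UnitAddTorus.mFourier m y = 0 :=
  finsum_mFourier_preimage_singleton_eq_zero (A ^ n) (T := T^[n]) (iterate_apply A hT n)
    (by rw [det_pow]; exact pow_ne_zero _ hA) (forall_vecMul_pow_ne_of_le A hN hn) x

/-! ### §2 Equidistribution of the fibres `T_A⁻ⁿ{xₙ}` under Rohlin's condition `⋂ₙ ℤ^d Aⁿ = 0` -/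

include hT in
/-- **The fibres of `T_Aⁿ` equidistribute toward the Haar measure.** Let `det A ≠ 0` and suppose Rohlin's
condition `⋂ₙ ℤ^d Aⁿ = {0}` (every `m ≠ 0` leaves `ℤ^d Aⁿ` for some `n`; ⟺ `T_A` exact,
`isExactEndomorphism_iff_forall_exists`).  Then for every continuous `g : 𝕋^d → ℂ` and EVERY sequence of base
points `xₙ ∈ 𝕋^d`, `|det A|⁻ⁿ Σ_{T_Aⁿ y = xₙ} g(y) → ∫ g dθ`: by §1 the character averages over the fibres are
eventually exactly `0`, and Weyl's criterion (§0) applies.  (Kernels: `xₙ = 0`; all preimages of a point: `xₙ = x`.)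
[cite: CuntzVershik2012, §2 (held text arXiv:1202.5960 chunk p0005)]
[cite: KuipersNiederreiter1974, Ch. 1 §6 Theorems 6.2–6.3] -/
theorem tendsto_finsetAvg_preimage_iterate (hA : A.det ≠ 0)
    (hR : ∀ m : d → ℤ, m ≠ 0 → ∃ n : ℕ, ∀ k : d → ℤ, k ᵥ* A ^ n ≠ m)
    (g : C(UnitAddTorus d, ℂ)) (x : ℕ → UnitAddTorus d) :
    Tendsto (fun n ↦ (∑ᶠ y ∈ (T^[n]) ⁻¹' {x n}, g y) / ((A.det.natAbs : ℂ) ^ n)) atTop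
      (𝓝 (∫ z : UnitAddTorus d, g z)) := by
  have hfin : ∀ n, ((T^[n]) ⁻¹' {x n}).Finite := fun n ↦ finite_preimage_iterate_singleton A hT hA n (x n)
  have hcard : ∀ n, ((hfin n).toFinset).card = A.det.natAbs ^ n := fun n ↦
    card_toFinset_preimage_iterate_singleton A hT hA n (x n)
  have hS : ∀ᶠ n in atTop, ((hfin n).toFinset).Nonempty := Eventually.of_forall fun n ↦
    Finset.card_pos.1 (by rw [hcard]; exact pow_pos (Int.natAbs_pos.2 hA) n)
  have hW : ∀ m : d → ℤ, m ≠ 0 → Tendsto (fun n ↦ (∑ y ∈ (hfin n).toFinset, UnitAddTorus.mFourier m y) /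
      (((hfin n).toFinset).card : ℂ)) atTop (𝓝 0) := by
    intro m hm
    obtain ⟨N, hN⟩ := hR m hm
    refine tendsto_const_nhds.congr' ?_
    filter_upwards [eventually_ge_atTop N] with n hn
    rw [← finsum_mem_eq_finite_toFinset_sum _ (hfin n), finsum_mFourier_preimage_iterate_eq_zero A hT hA hN hn (x n), zero_div]
  refine (tendsto_finsetAvg_of_forall_mFourier hS hW g).congr' (Eventually.of_forall fun n ↦ ?_)
  beta_reduce
  rw [finsum_mem_eq_finite_toFinset_sum _ (hfin n), hcard n, Nat.cast_pow]

include hT in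
/-- **Equidistribution of the fibres, real-valued test functions**: under Rohlin's condition,
`|det A|⁻ⁿ Σ_{T_Aⁿ y = xₙ} g(y) → ∫ g dθ` for every continuous `g : 𝕋^d → ℝ` and every sequence `xₙ`.
[cite: CuntzVershik2012, §2 (held text arXiv:1202.5960 chunk p0005)]
[cite: KuipersNiederreiter1974, Ch. 1 §6 Theorems 6.2–6.3] -/
theorem tendsto_finsetAvg_preimage_iterate_real (hA : A.det ≠ 0)
    (hR : ∀ m : d → ℤ, m ≠ 0 → ∃ n : ℕ, ∀ k : d → ℤ, k ᵥ* A ^ n ≠ m)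
    (g : C(UnitAddTorus d, ℝ)) (x : ℕ → UnitAddTorus d) :
    Tendsto (fun n ↦ (∑ᶠ y ∈ (T^[n]) ⁻¹' {x n}, g y) / ((A.det.natAbs : ℝ) ^ n)) atTop
      (𝓝 (∫ z : UnitAddTorus d, g z)) := by
  have hfin : ∀ n, ((T^[n]) ⁻¹' {x n}).Finite := fun n ↦ finite_preimage_iterate_singleton A hT hA n (x n)
  have hcard : ∀ n, ((hfin n).toFinset).card = A.det.natAbs ^ n := fun n ↦
    card_toFinset_preimage_iterate_singleton A hT hA n (x n)
  have hS : ∀ᶠ n in atTop, ((hfin n).toFinset).Nonempty := Eventually.of_forall fun n ↦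
    Finset.card_pos.1 (by rw [hcard]; exact pow_pos (Int.natAbs_pos.2 hA) n)
  have hW : ∀ m : d → ℤ, m ≠ 0 → Tendsto (fun n ↦ (∑ y ∈ (hfin n).toFinset, UnitAddTorus.mFourier m y) /
      (((hfin n).toFinset).card : ℂ)) atTop (𝓝 0) := by
    intro m hm
    obtain ⟨N, hN⟩ := hR m hm
    refine tendsto_const_nhds.congr' ?_
    filter_upwards [eventually_ge_atTop N] with n hn
    rw [← finsum_mem_eq_finite_toFinset_sum _ (hfin n), finsum_mFourier_preimage_iterate_eq_zero A hT hA hN hn (x n), zero_div]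
  refine (tendsto_finsetAvg_real_of_forall_mFourier hS hW g).congr' (Eventually.of_forall fun n ↦ ?_)
  beta_reduce
  rw [finsum_mem_eq_finite_toFinset_sum _ (hfin n), hcard n, Nat.cast_pow]

include hT in
/-- **The kernels `ker T_Aⁿ` equidistribute toward the Haar measure** under Rohlin's condition
(`tendsto_finsetAvg_preimage_iterate` with `xₙ = 0`): `|det A|⁻ⁿ Σ_{y ∈ ker T_Aⁿ} g(y) → ∫ g dθ`.
[cite: CuntzVershik2012, §2 (held text arXiv:1202.5960 chunk p0005)]
[cite: KuipersNiederreiter1974, Ch. 1 §6 Theorems 6.2–6.3] -/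
theorem tendsto_finsetAvg_ker_iterate (hA : A.det ≠ 0)
    (hR : ∀ m : d → ℤ, m ≠ 0 → ∃ n : ℕ, ∀ k : d → ℤ, k ᵥ* A ^ n ≠ m) (g : C(UnitAddTorus d, ℂ)) :
    Tendsto (fun n ↦ (∑ᶠ y ∈ (T^[n]) ⁻¹' {0}, g y) / ((A.det.natAbs : ℂ) ^ n)) atTop
      (𝓝 (∫ z : UnitAddTorus d, g z)) :=
  tendsto_finsetAvg_preimage_iterate A hT hA hR g fun _ ↦ 0

/-! ### §3 Density of `⋃ₙ ker T_Aⁿ` -/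

include hT in
/-- **Equidistribution of the kernels forces `⋃ₙ ker T_Aⁿ` to be dense**: if the averages over `ker T_Aⁿ` of every
continuous real `g` tend to `∫ g dθ`, then `⋃ₙ ker T_Aⁿ` is dense — otherwise a Urysohn function `g ≥ 0` vanishing
on the closure and equal to `1` at a point outside has all kernel averages `0` but `∫ g dθ > 0` (the Haar measure
charges open sets). [cite: CuntzVershik2012, §2 (held text arXiv:1202.5960 chunk p0005)] -/
theorem dense_iUnion_ker_iterate_of_tendsto (hA : A.det ≠ 0)
    (h : ∀ g : C(UnitAddTorus d, ℝ), Tendsto (fun n ↦ (∑ᶠ y ∈ (T^[n]) ⁻¹' {0}, g y) / ((A.det.natAbs : ℝ) ^ n))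
      atTop (𝓝 (∫ z : UnitAddTorus d, g z))) :
    Dense (⋃ n : ℕ, (T^[n]) ⁻¹' ({0} : Set (UnitAddTorus d))) := by
  by_contra hnd
  obtain ⟨x₀, hx₀⟩ : ∃ x₀ : UnitAddTorus d, x₀ ∉ closure (⋃ n : ℕ, (T^[n]) ⁻¹' ({0} : Set (UnitAddTorus d))) := by
    by_contra hall
    push Not at hall
    exact hnd fun x ↦ hall x
  obtain ⟨g, hg0, hg1, hg01⟩ := exists_continuous_zero_one_of_isClosed isClosed_closure isClosed_singleton
    (Set.disjoint_singleton_right.2 hx₀)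
  -- the kernel averages of `g` vanish identically
  have havg : ∀ n, (∑ᶠ y ∈ (T^[n]) ⁻¹' {0}, g y) / ((A.det.natAbs : ℝ) ^ n) = 0 := fun n ↦ by
    have hzero : ∀ y ∈ (T^[n]) ⁻¹' ({0} : Set (UnitAddTorus d)), g y = 0 := fun y hy ↦
      hg0 (subset_closure (Set.mem_iUnion.2 ⟨n, hy⟩))
    rw [finsum_mem_eq_finite_toFinset_sum _ (finite_preimage_iterate_singleton A hT hA n 0),
      Finset.sum_eq_zero fun y hy ↦ hzero y ((Set.Finite.mem_toFinset _).1 hy), zero_div]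
  have hlim := h g
  simp_rw [havg] at hlim
  -- but `∫ g dθ > 0`
  haveI : (volume : Measure (UnitAddTorus d)).IsOpenPosMeasure := by
    rw [MeasureTheory.volume_pi]
    infer_instance
  have hpos : 0 < ∫ z : UnitAddTorus d, g z :=
    g.continuous.integral_pos_of_hasCompactSupport_nonneg_nonzero (HasCompactSupport.of_compactSpace g)
      (fun z ↦ (hg01 z).1) (x := x₀) (by rw [hg1 rfl]; exact one_ne_zero)
  have h0 : (0 : ℝ) = ∫ z : UnitAddTorus d, g z := tendsto_nhds_unique tendsto_const_nhds hlim
  exact (lt_irrefl (0 : ℝ)) (h0 ▸ hpos)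

include hT in
/-- **`⋃ₙ ker T_Aⁿ` is dense under Rohlin's condition `⋂ₙ ℤ^d Aⁿ = 0`** (`det A ≠ 0`) — Cuntz–Vershik's «by
duality», here through the equidistribution of the kernels (§2) and `dense_iUnion_ker_iterate_of_tendsto`.
[cite: CuntzVershik2012, §2 (held text arXiv:1202.5960 chunk p0005)] -/
theorem dense_iUnion_ker_iterate_of_forall_exists (hA : A.det ≠ 0)
    (hR : ∀ m : d → ℤ, m ≠ 0 → ∃ n : ℕ, ∀ k : d → ℤ, k ᵥ* A ^ n ≠ m) :
    Dense (⋃ n : ℕ, (T^[n]) ⁻¹' ({0} : Set (UnitAddTorus d))) :=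
  dense_iUnion_ker_iterate_of_tendsto A hT hA fun g ↦ tendsto_finsetAvg_preimage_iterate_real A hT hA hR g fun _ ↦ 0

/-! ### §4 The converse: a dense `⋃ₙ ker T_Aⁿ` forces `⋂ₙ ℤ^d Aⁿ = 0` -/

include hT in
/-- **If `⋃ₙ ker T_Aⁿ` is dense then `⋂ₙ ℤ^d Aⁿ = {0}`** (no hypothesis on `det A`): for `0 ≠ m = k_n Aⁿ` (all
`n`) the character `χ_m = χ_{k_n} ∘ T_Aⁿ` is `≡ 1` on `ker T_Aⁿ` for every `n`, hence on the dense union, hence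
everywhere — but only the trivial character is `≡ 1`. [cite: CuntzVershik2012, §2 (held text arXiv:1202.5960 chunk p0005)]
[cite: Walters1982, §0.8 (held text chunk p0043)] -/
theorem forall_exists_of_dense_iUnion_ker_iterate (hd : Dense (⋃ n : ℕ, (T^[n]) ⁻¹' ({0} : Set (UnitAddTorus d)))) :
    ∀ m : d → ℤ, m ≠ 0 → ∃ n : ℕ, ∀ k : d → ℤ, k ᵥ* A ^ n ≠ m := by
  intro m hm0
  by_contra h
  push Not at h
  have h1 : Set.EqOn (UnitAddTorus.mFourier m) (fun _ ↦ (1 : ℂ)) (⋃ n : ℕ, (T^[n]) ⁻¹' ({0} : Set (UnitAddTorus d))) := by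
    intro y hy
    obtain ⟨n, hn⟩ := Set.mem_iUnion.1 hy
    obtain ⟨k, hk⟩ := h n
    have hy0 : T^[n] y = 0 := hn
    change UnitAddTorus.mFourier m y = 1
    rw [← hk, ← mFourier_iterate_apply A hT k n y, hy0, mFourier_apply_zero]
  have h2 : (UnitAddTorus.mFourier m : UnitAddTorus d → ℂ) = fun _ ↦ 1 :=
    Continuous.ext_on hd (UnitAddTorus.mFourier m).continuous continuous_const h1
  exact hm0 (eq_zero_of_forall_mFourier_eq_one fun y ↦ congr_fun h2 y)

/-! ### §5 The printed theorem: exact ⟺ `⋃ₙ ker T_Aⁿ` dense, and its companions -/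

include hT in
/-- **`⋃ₙ ker T_Aⁿ` is dense ⟺ `⋂ₙ ℤ^d Aⁿ = {0}`** (`det A ≠ 0`) — the duality statement of Cuntz–Vershik §2 for
`H = 𝕋^d`. [cite: CuntzVershik2012, §2 (held text arXiv:1202.5960 chunk p0005)] -/
theorem dense_iUnion_ker_iterate_iff_forall_exists (hA : A.det ≠ 0) :
    Dense (⋃ n : ℕ, (T^[n]) ⁻¹' ({0} : Set (UnitAddTorus d))) ↔
      ∀ m : d → ℤ, m ≠ 0 → ∃ n : ℕ, ∀ k : d → ℤ, k ᵥ* A ^ n ≠ m :=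
  ⟨forall_exists_of_dense_iUnion_ker_iterate A hT, dense_iUnion_ker_iterate_of_forall_exists A hT hA⟩

include hT in
/-- **Cuntz–Vershik §2 (after Rohlin) on the torus: `T_A` is an exact endomorphism iff `⋃ₙ ker T_Aⁿ` is dense in
`𝕋^d`** (`det A ≠ 0`; «For an algebraic endomorphism of the compact group `H` this condition [exactness] means
exactly that the subgroup `⋃_{n∈ℕ} Ker αⁿ` is dense in `H`»): both are equivalent to Rohlin's `⋂ₙ ℤ^d Aⁿ = 0`
(the tree's `isExactEndomorphism_iff_forall_exists` and §3–§4).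
[cite: CuntzVershik2012, §2 (held text arXiv:1202.5960 chunk p0005)] [cite: Rohlin1964, §3]
[cite: Walters1982, §4.9 Definition 4.14 (held text chunk p0126)] -/
theorem isExactEndomorphism_iff_dense_iUnion_ker_iterate (hA : A.det ≠ 0) :
    IsExactEndomorphism T volume ↔ Dense (⋃ n : ℕ, (T^[n]) ⁻¹' ({0} : Set (UnitAddTorus d))) := by
  rw [isExactEndomorphism_iff_forall_exists A hT hA, dense_iUnion_ker_iterate_iff_forall_exists A hT hA]

include hT in
/-- **`⋃ₙ ker T_Aⁿ` is dense iff no unimodular polynomial divides `χ_A`** (`det A ≠ 0`; Krzyżewski's theorem,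
Andersen–Thomsen Thm. 4.1, read through `isExactEndomorphism_iff_dense_iUnion_ker_iterate`).
[cite: CuntzVershik2012, §2 (held text arXiv:1202.5960 chunk p0005)]
[cite: AndersenThomsen2012, §4 Theorem 4.1 (held text arXiv:1204.0224 chunk p0010)] [cite: Krzyzewski1993, Theorem (abstract)] -/
theorem dense_iUnion_ker_iterate_iff_forall_not_dvd_charpoly (hA : A.det ≠ 0) :
    Dense (⋃ n : ℕ, (T^[n]) ⁻¹' ({0} : Set (UnitAddTorus d))) ↔
      ∀ g : Polynomial ℤ, g.Monic → 0 < g.natDegree → IsUnit (g.coeff 0) → ¬ g ∣ A.charpoly := by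
  rw [← isExactEndomorphism_iff_dense_iUnion_ker_iterate A hT hA, isExactEndomorphism_iff_forall_not_dvd_charpoly A hT hA]

include hT in
/-- **`T_A` is exact iff its kernels equidistribute toward the Haar measure**: for `det A ≠ 0`, `T_A` is an exact
endomorphism iff `|det A|⁻ⁿ Σ_{y ∈ ker T_Aⁿ} g(y) → ∫ g dθ` for every continuous `g : 𝕋^d → ℂ`.
[cite: CuntzVershik2012, §2 (held text arXiv:1202.5960 chunk p0005)] [cite: KuipersNiederreiter1974, Ch. 1 §6 Theorems 6.2–6.3] -/
theorem isExactEndomorphism_iff_tendsto_finsetAvg_ker_iterate (hA : A.det ≠ 0) :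
    IsExactEndomorphism T volume ↔ ∀ g : C(UnitAddTorus d, ℂ),
      Tendsto (fun n ↦ (∑ᶠ y ∈ (T^[n]) ⁻¹' {0}, g y) / ((A.det.natAbs : ℂ) ^ n)) atTop
        (𝓝 (∫ z : UnitAddTorus d, g z)) := by
  rw [isExactEndomorphism_iff_forall_exists A hT hA]
  refine ⟨fun hR g ↦ tendsto_finsetAvg_ker_iterate A hT hA hR g, fun h ↦ ?_⟩
  refine forall_exists_of_dense_iUnion_ker_iterate A hT (dense_iUnion_ker_iterate_of_tendsto A hT hA fun g ↦ ?_)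
  -- real test functions through their complexification
  set gc : C(UnitAddTorus d, ℂ) := (⟨Complex.ofReal, Complex.continuous_ofReal⟩ : C(ℝ, ℂ)).comp g with hgc
  have h1 := h gc
  have h2 := (Complex.continuous_re.tendsto _).comp h1
  simp only [hgc, ContinuousMap.comp_apply, ContinuousMap.coe_mk, Function.comp_def] at h2
  convert h2 using 2 with n
  · rw [finsum_mem_eq_finite_toFinset_sum _ (finite_preimage_iterate_singleton A hT hA n 0),
      finsum_mem_eq_finite_toFinset_sum _ (finite_preimage_iterate_singleton A hT hA n 0), ← Complex.ofReal_sum,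
      ← Complex.ofReal_natCast, ← Complex.ofReal_pow, ← Complex.ofReal_div, Complex.ofReal_re]
  · rw [integral_complex_ofReal, Complex.ofReal_re]

include hT in
/-- **An exact `T_A` has equidistributed fibres**: if `T_A` is exact (`det A ≠ 0`) then
`|det A|⁻ⁿ Σ_{T_Aⁿ y = xₙ} g(y) → ∫ g dθ` for every continuous `g` and every sequence of base points `xₙ`.
[cite: CuntzVershik2012, §2 (held text arXiv:1202.5960 chunk p0005)] [cite: KuipersNiederreiter1974, Ch. 1 §6 Theorems 6.2–6.3] -/
theorem IsExactEndomorphism.tendsto_finsetAvg_preimage_iterate (hA : A.det ≠ 0) (hex : IsExactEndomorphism T volume)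
    (g : C(UnitAddTorus d, ℂ)) (x : ℕ → UnitAddTorus d) :
    Tendsto (fun n ↦ (∑ᶠ y ∈ (T^[n]) ⁻¹' {x n}, g y) / ((A.det.natAbs : ℂ) ^ n)) atTop
      (𝓝 (∫ z : UnitAddTorus d, g z)) :=
  ToralEndomorphism.tendsto_finsetAvg_preimage_iterate A hT hA ((isExactEndomorphism_iff_forall_exists A hT hA).1 hex) g x

include hT in
/-- **An exact `T_A` has dense `⋃ₙ ker T_Aⁿ`.** [cite: CuntzVershik2012, §2 (held text arXiv:1202.5960 chunk p0005)] -/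
theorem IsExactEndomorphism.dense_iUnion_ker_iterate (hA : A.det ≠ 0) (hex : IsExactEndomorphism T volume) :
    Dense (⋃ n : ℕ, (T^[n]) ⁻¹' ({0} : Set (UnitAddTorus d))) :=
  (isExactEndomorphism_iff_dense_iUnion_ker_iterate A hT hA).1 hex

include hT in
/-- **Expanding endomorphisms have dense iterated kernels**: if every complex eigenvalue of `A` has modulus `> 1`
then `⋃ₙ ker T_Aⁿ` is dense (expanding ⟹ exact, `isExactEndomorphism_of_forall_one_lt_norm`).
[cite: CuntzVershik2012, §2 (held text arXiv:1202.5960 chunk p0005)]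
[cite: AndersenThomsen2012, §4 Theorem 4.1 / Theorem 4.3 (1) (held text arXiv:1204.0224 chunks p0010, p0014)] -/
theorem dense_iUnion_ker_iterate_of_forall_one_lt_norm
    (hexp : ∀ α ∈ (A.map (Int.castRingHom ℂ)).charpoly.roots, 1 < ‖α‖) :
    Dense (⋃ n : ℕ, (T^[n]) ⁻¹' ({0} : Set (UnitAddTorus d))) := by
  have hex := isExactEndomorphism_of_forall_one_lt_norm A hT hexp
  -- an expanding matrix is non-singular: `0` is not a root of `χ_A`
  have hA : A.det ≠ 0 := by
    intro hA0
    have hdetC : (A.map (Int.castRingHom ℂ)).det = 0 := by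
      rw [← RingHom.mapMatrix_apply, ← RingHom.map_det, hA0, map_zero]
    have hcoeff : (A.map (Int.castRingHom ℂ)).charpoly.coeff 0 = 0 := by
      have h := Matrix.det_eq_sign_charpoly_coeff (A.map (Int.castRingHom ℂ))
      rw [hdetC] at h
      exact (mul_eq_zero.1 h.symm).resolve_left (pow_ne_zero _ (neg_ne_zero.2 one_ne_zero))
    have h0 : (0 : ℂ) ∈ (A.map (Int.castRingHom ℂ)).charpoly.roots := by
      rw [Polynomial.mem_roots (Matrix.charpoly_monic _).ne_zero, Polynomial.IsRoot,
        ← Polynomial.coeff_zero_eq_eval_zero, hcoeff]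
    have := hexp 0 h0
    rw [norm_zero] at this
    exact (lt_irrefl (0 : ℝ)) (zero_lt_one.trans this)
  exact (isExactEndomorphism_iff_dense_iUnion_ker_iterate A hT hA).1 hex

include hT in
/-- **Automorphisms have no dense iterated kernels**: if `det A = ±1` then `⋃ₙ ker T_Aⁿ = {0}` is not dense
(`d ≠ ∅`; `T_A` is not exact — `not_isExactEndomorphism_of_isUnit_det`).
[cite: CuntzVershik2012, §2 (held text arXiv:1202.5960 chunk p0005)] [cite: Walters1982, §4.9 Definition 4.14 and the remark after it (held text chunk p0126)] -/
theorem not_dense_iUnion_ker_iterate_of_isUnit_det [Nonempty d] (hA : IsUnit A.det) :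
    ¬ Dense (⋃ n : ℕ, (T^[n]) ⁻¹' ({0} : Set (UnitAddTorus d))) := by
  rw [← isExactEndomorphism_iff_dense_iUnion_ker_iterate A hT hA.ne_zero]
  exact not_isExactEndomorphism_of_isUnit_det A hT hA

end ToralEndomorphism

/-! ### §6 The torsion levels `𝕋^d[m]` and the `m`-division points of a point equidistribute as `m → ∞` -/

section Torsion

variable {d : Type*} [Fintype d] [DecidableEq d]

/-- Multiplication by `m` on `𝕋^d` is `T_{m·1}`. [cite: Walters1982, §5.3 proof of Theorem 5.11 (held text chunk p0141)] -/
private theorem nsmul_apply_eq_sum (m : ℕ) (x : UnitAddTorus d) (i : d) :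
    (m • x) i = ∑ j, (((m : ℤ) • (1 : Matrix d d ℤ)) i j) • x j := by
  simp only [Matrix.smul_apply, Matrix.one_apply, smul_eq_mul, mul_ite, mul_one, mul_zero, ite_smul, zero_smul,
    Finset.sum_ite_eq, Finset.mem_univ, if_true, Pi.smul_apply, natCast_zsmul]

/-- `k ∈ ℤ^d (m·1)` with `m > |k_i|` for some `k_i ≠ 0` is impossible: `k' (m·1) = m k'`.
[cite: Walters1982, §5.3 proof of Theorem 5.11 (held text chunk p0141)] -/
private theorem forall_vecMul_smul_one_ne {k : d → ℤ} {i : d} (hi : k i ≠ 0) {m : ℕ} (hm : (k i).natAbs < m) :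
    ∀ k' : d → ℤ, k' ᵥ* ((m : ℤ) • (1 : Matrix d d ℤ)) ≠ k := by
  intro k' hk'
  rw [Matrix.vecMul_smul, Matrix.vecMul_one] at hk'
  have hdvd : (m : ℤ) ∣ k i := ⟨k' i, by rw [← hk']; simp [mul_comm]⟩
  exact hi (Int.eq_zero_of_dvd_of_natAbs_lt_natAbs hdvd (by rwa [Int.natAbs_natCast]))

/-- **The `m`-division points of any points `xₘ ∈ 𝕋^d` equidistribute toward the Haar measure as `m → ∞`**:
`m^{-d} Σ_{m y = xₘ} g(y) → ∫ g dθ` for every continuous `g : 𝕋^d → ℂ` (each fibre of `y ↦ m y` has `m^d` points;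
a character `χ_k`, `k ≠ 0`, sums to `0` over it as soon as `m > |k_i|` for some `k_i ≠ 0`, since `ℤ^d (m·1) = m ℤ^d`;
Weyl's criterion §0).  With `xₘ = 0`: the torsion levels `𝕋^d[m] = {y : m y = 0}` («`Y_k = {z ∈ Kⁿ : z^k = e}` is a
finite subgroup») equidistribute. [cite: Walters1982, §5.3 Theorem 5.11 and its proof (held text chunk p0141)]
[cite: KuipersNiederreiter1974, Ch. 1 §6 Theorems 6.2–6.3] -/
theorem tendsto_finsetAvg_nsmul (g : C(UnitAddTorus d, ℂ)) (x : ℕ → UnitAddTorus d) :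
    Tendsto (fun m : ℕ ↦ (∑ᶠ y ∈ (fun z : UnitAddTorus d ↦ m • z) ⁻¹' {x m}, g y) / ((m : ℂ) ^ Fintype.card d))
      atTop (𝓝 (∫ z : UnitAddTorus d, g z)) := by
  -- the fibres of `y ↦ m • y`, `m ≥ 1`, as finite sets with `m^d` elements
  have hdet : ∀ m : ℕ, 0 < m → (((m : ℤ) • (1 : Matrix d d ℤ))).det ≠ 0 := fun m hm ↦ by
    rw [Matrix.det_smul, Matrix.det_one, mul_one]
    exact pow_ne_zero _ (by exact_mod_cast hm.ne')
  have hfin : ∀ m : ℕ, 0 < m → ((fun z : UnitAddTorus d ↦ m • z) ⁻¹' {x m}).Finite := fun m hm ↦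
    ToralEndomorphism.finite_preimage_singleton ((m : ℤ) • (1 : Matrix d d ℤ)) (T := fun z : UnitAddTorus d ↦ m • z)
      (nsmul_apply_eq_sum m) (hdet m hm) (x m)
  classical
  set S : ℕ → Finset (UnitAddTorus d) := fun m ↦ if hm : 0 < m then (hfin m hm).toFinset else ∅ with hSdef
  have hS_of_pos : ∀ m : ℕ, ∀ hm : 0 < m, S m = (hfin m hm).toFinset := fun m hm ↦ by rw [hSdef]; simp [hm]
  have hcard : ∀ m : ℕ, 0 < m → (S m).card = m ^ Fintype.card d := fun m hm ↦ by
    rw [hS_of_pos m hm, ← Set.ncard_eq_toFinset_card _ (hfin m hm), ← Nat.card_coe_set_eq,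
      ToralEndomorphism.natCard_preimage_singleton ((m : ℤ) • (1 : Matrix d d ℤ)) (T := fun z : UnitAddTorus d ↦ m • z)
        (nsmul_apply_eq_sum m) (hdet m hm) (x m), Matrix.det_smul, Matrix.det_one, mul_one, Int.natAbs_pow,
      Int.natAbs_natCast]
  have hS : ∀ᶠ m in atTop, (S m).Nonempty := by
    filter_upwards [eventually_gt_atTop 0] with m hm
    exact Finset.card_pos.1 (by rw [hcard m hm]; exact pow_pos hm _)
  have hW : ∀ k : d → ℤ, k ≠ 0 →
      Tendsto (fun m ↦ (∑ y ∈ S m, UnitAddTorus.mFourier k y) / ((S m).card : ℂ)) atTop (𝓝 0) := by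
    intro k hk
    obtain ⟨i, hi⟩ := Function.ne_iff.1 hk
    refine tendsto_const_nhds.congr' ?_
    filter_upwards [eventually_gt_atTop (k i).natAbs] with m hm
    have hm0 : 0 < m := lt_of_le_of_lt (Nat.zero_le _) hm
    rw [hS_of_pos m hm0, ← finsum_mem_eq_finite_toFinset_sum _ (hfin m hm0),
      ToralEndomorphism.finsum_mFourier_preimage_singleton_eq_zero ((m : ℤ) • (1 : Matrix d d ℤ))
        (T := fun z : UnitAddTorus d ↦ m • z) (nsmul_apply_eq_sum m) (hdet m hm0)
        (forall_vecMul_smul_one_ne hi hm) (x m), zero_div]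
  refine (tendsto_finsetAvg_of_forall_mFourier hS hW g).congr' ?_
  filter_upwards [eventually_gt_atTop 0] with m hm
  rw [hS_of_pos m hm, finsum_mem_eq_finite_toFinset_sum _ (hfin m hm), ← hS_of_pos m hm, hcard m hm, Nat.cast_pow]

/-- **The torsion levels `𝕋^d[m]` equidistribute toward the Haar measure as `m → ∞`**:
`m^{-d} Σ_{m y = 0} g(y) → ∫ g dθ` for every continuous `g`. [cite: Walters1982, §5.3 Theorem 5.11 and its proof (held text chunk p0141)]
[cite: KuipersNiederreiter1974, Ch. 1 §6 Theorems 6.2–6.3] -/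
theorem tendsto_finsetAvg_nsmul_eq_zero (g : C(UnitAddTorus d, ℂ)) :
    Tendsto (fun m : ℕ ↦ (∑ᶠ y ∈ (fun z : UnitAddTorus d ↦ m • z) ⁻¹' {0}, g y) / ((m : ℂ) ^ Fintype.card d))
      atTop (𝓝 (∫ z : UnitAddTorus d, g z)) :=
  tendsto_finsetAvg_nsmul g fun _ ↦ 0

end Torsion

end Literature.Dynamics.Ergodic
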